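import Mathlib.Algebra.Lie.Prod
import Literature.Algebra.Lie.LefschetzGenericGeneration
import Literature.Algebra.Lie.LefschetzJordanCriterion
import Literature.Algebra.Lie.LefschetzModuleDirectSum
import Literature.Algebra.Lie.ReductiveIdealsQuotients
import HarnessLib

/-!
# One `𝔞` acting on two Lefschetz triples: the subdirect product `𝔤 ≤ 𝔤' × 𝔤''` is a Lefschetz triple (Looijenga–Lunts 1997, §1 p. 4)

Topic `Literature/Algebra/Lie` (namespace `Literature.Algebra.Lie`).  Lane `lit-hodgefound` (Track 2 foundations
library), skeleton seat `lit-hodgefound-skel-1` (generation 45), row **A1-140** of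
`run/shared/lean/pub/lit-hodgefound/SKELETON.md`.  Sequel of `LefschetzGenericGeneration.lean` (A1-139: `𝔞` and the
partners of any non-empty line-open subset of `dom f` generate `𝔤(𝔞, ·)`), `LefschetzJordanCriterion.lean` (A1-113: the
Lefschetz locus of a Lefschetz TRIPLE is Zariski open along lines, `IsLefschetzTriple.finite_setOf_add_smul_not_mem_lefschetzDomain`
— A1-111 through the adjoint module of A1-101), `LefschetzModuleAdjoint.lean` (A1-101: `inSubalgebra`, `map_lieSpan`) and
`ReductiveIdealsQuotients.lean` (Bourbaki I §5–§6: `map_radical_le_of_surjective`).  PROVED theorems only: no definition, no named fact, no instance, no `sorry`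
(D-0026 net debt `0`).

## Source, VERBATIM

E. Looijenga, V. A. Lunts, *A Lie algebra attached to a projective variety*, Invent. Math. **129** (1997) 361–412,
§1 (held TeX text `paper:arxiv-alg-geom_9604014`), p0004 L62–L64 and L72–L88:

> "The collection of Lefschetz modules is closed under direct sums, tensor products and taking duals."
> "There is also an exterior direct sum and tensor product: if `(𝔞', M')` and `(𝔞'', M'')` are Lefschetz modules,
> then we have defined Lefschetz modules `(𝔞' × 𝔞'', M' ⊞ M'')` […] `(𝔞' × 𝔞'', M' ⊠ M'')` […]. The associated Lie
> algebra is in the first case equal to `𝔤(𝔞', M') × 𝔤(𝔞'', M'')`. This is also true in the second case if both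
> factors are nonzero."

and §1 p0007 L54–L78 (Lefschetz triples `(𝔤, h, 𝔞)`; "This reduces the classification of Lefschetz modules to
classifying triples `(𝔤, h, 𝔞)`").

## Statement (the algebraic content of "closed under direct sums, tensor products" for ONE `𝔞`)

The first sentence concerns a SINGLE `𝔞` acting on two modules `M'`, `M''` (the exterior constructions of the second
sentence, with `𝔞' × 𝔞''`, are rows A1-99 / A1-104 / A1-105).  Its Lie-theoretic core, in the "Tannakian spirit" of
p0007: let `(𝔤', h', 𝔞')` and `(𝔤'', h'', 𝔞'')` be Lefschetz triples (finite-dimensional, characteristic `0`) and let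
`𝔠 ≤ 𝔤' × 𝔤''` be a subspace projecting ONTO `𝔞'` and ONTO `𝔞''` — "the same `𝔞`" seen in both (for one `𝔞` with
structure maps `e' : 𝔞 → 𝔞'`, `e'' : 𝔞 → 𝔞''` take `𝔠 = {(e'_a, e''_a)}`; `𝔠 = 𝔞' × 𝔞''` is the exterior case).  Then,
with `h = (h', h'')` and `𝔤 := 𝔤(𝔠, ·) ≤ 𝔤' × 𝔤''` the Lie subalgebra generated by `𝔠` and the partners of its
Lefschetz elements:

* `dom f` on `𝔠` consists of the `c ∈ 𝔠` BOTH of whose components are Lefschetz (`mem_lefschetzDomain_common_iff`), it is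
  line-open (`finite_setOf_add_smul_notMem_lefschetzDomain_common`) and NON-EMPTY (`nonempty_lefschetzDomain_common` — two
  Zariski-open conditions along a line, A1-113's line-openness for each factor);
* `𝔤` projects ONTO `𝔤'` and ONTO `𝔤''` (**`map_fst_lefschetzLieAlgebra_common_eq_top`**, `map_snd_…`): the projection is
  generated by `𝔞'` and the partners `f'_a` of the `a` Lefschetz on both sides — a line-open set — which suffice by
  GENERIC GENERATION (A1-139);
* hence `𝔤` is a SUBDIRECT PRODUCT of semisimple Lie algebras, so semisimple
  (**`hasTrivialRadical_of_map_fst_map_snd_eq_top`**: the radical maps into both radicals, Bourbaki I §5), and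
  **`(𝔤, h, 𝔠)` is a Lefschetz triple** (**`isLefschetzTriple_lefschetzLieAlgebra_common`**);
* §3 (rider) the exterior case `𝔠 = 𝔞' × 𝔞''`: `𝔤(𝔞' × 𝔞'', ·) = 𝔤' × 𝔤''` (**`lefschetzLieAlgebra_prod_submodule_eq_top`**)
  and **`IsLefschetzTriple.prod`** — the exterior direct sum of Lefschetz triples;
* §4 (rider, generation 51) the Jordan case: `adDegree_prod_eq` (`𝔤_c(h', h'') = 𝔤'_c × 𝔤''_c`) and
  **`IsJordanLefschetzPair.prod`** — the product of two Jordan–Lefschetz pairs `(𝔤', h')`, `(𝔤'', h'')` is the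
  Jordan–Lefschetz pair `(𝔤' × 𝔤'', (h', h''))` (how the non-simple pairs arise from the list (2.6)).

Every representation `V` of `𝔤' × 𝔤''` with `h V ≠ 0` — `M' ⊕ M''`, `M' ⊗ M''`, … — is then a Lefschetz module of `𝔠`
with `𝔤(𝔠, V)` the image of `𝔤` (A1-106 `IsLefschetzTriple.isLefschetzModule_toEnd`, A1-137
`IsLefschetzTriple.isLefschetzModule_of_lieHom`); the module-level corollaries are row A1-141.

## SCOPE (what is NOT formalised here)

(a) The module-level statements (`IsLefschetzModule` for `M' ⊕ M''`, `M' ⊗ M''` under one `𝔞`) are the next row.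
(b) For a general `𝔠` only "subdirect" holds (`𝔠 = K(e, e) ≤ 𝔰𝔩₂ × 𝔰𝔩₂` gives the diagonal `𝔰𝔩₂`); for the
exterior case `𝔠 = 𝔞' × 𝔞''` §3 (rider) proves the source's "equal to `𝔤(𝔞', M') × 𝔤(𝔞'', M'')`" at the level of triples
(`lefschetzLieAlgebra_prod_submodule_eq_top`, `IsLefschetzTriple.prod`; the module level is A1-99).  (c) Nothing here concerns complex tori or the Hodge conjecture.

## References

* [LooijengaLunts1997] E. Looijenga, V. A. Lunts, *A Lie algebra attached to a projective variety*, Invent. Math. 129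
  (1997) 361–412; arXiv:alg-geom/9604014. §1 p. 4 L62–L64, L72–L88; §1 p. 7 L54–L78 (held `paper:arxiv-alg-geom_9604014`).
* [Bourbaki1989LieGroups13] N. Bourbaki, *Lie Groups and Lie Algebras, Chapters 1–3*, Ch. I §5 no. 2 (radical of a
  product), §6 no. 1 Remark 3 — via the tree's `map_radical_le_of_surjective`.
-/

namespace Literature.Algebra.Lie

open Module Function Set LieModule LieAlgebra

/-! ### §1 `𝔰𝔩₂`-triples, the grading and subdirect products in `𝔤' × 𝔤''` -/

section Prod

variable {K : Type*} [CommRing K] {L₁ L₂ : Type*} [LieRing L₁] [LieAlgebra K L₁] [LieRing L₂] [LieAlgebra K L₂]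

/-- An `𝔰𝔩₂`-triple of `𝔤' × 𝔤''` with `h = (h', h'')`, `h', h'' ≠ 0`, is a pair of `𝔰𝔩₂`-triples ("upon writing
`h = (h', h'') ∈ 𝔤' × 𝔤''` … `[h, f] = -2f` implies `[h', f'] = -2f'` and `[h'', f''] = -2f''`").
[cite: LooijengaLunts1997, §1 (1.2) proof p0004 L102–L111] -/
theorem isSl2Triple_prod_iff {h₁ e₁ f₁ : L₁} {h₂ e₂ f₂ : L₂} (h₁0 : h₁ ≠ 0) (h₂0 : h₂ ≠ 0) :
    IsSl2Triple ((h₁, h₂) : L₁ × L₂) (e₁, e₂) (f₁, f₂) ↔ IsSl2Triple h₁ e₁ f₁ ∧ IsSl2Triple h₂ e₂ f₂ := by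
  constructor
  · intro t
    have h1 := t.lie_e_f
    have h2 := t.lie_h_e_nsmul
    have h3 := t.lie_h_f_nsmul
    simp only [LieAlgebra.Prod.bracket_apply, Prod.mk.injEq, Prod.smul_mk, Prod.neg_mk] at h1 h2 h3
    exact ⟨⟨h₁0, h1.1, h2.1, h3.1⟩, ⟨h₂0, h1.2, h2.2, h3.2⟩⟩
  · rintro ⟨t₁, t₂⟩
    refine ⟨fun h0 ↦ h₁0 (congrArg Prod.fst h0), ?_, ?_, ?_⟩
    · simp only [LieAlgebra.Prod.bracket_apply, t₁.lie_e_f, t₂.lie_e_f]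
    · simp only [LieAlgebra.Prod.bracket_apply, t₁.lie_h_e_nsmul, t₂.lie_h_e_nsmul, Prod.smul_mk]
    · simp only [LieAlgebra.Prod.bracket_apply, t₁.lie_h_f_nsmul, t₂.lie_h_f_nsmul, Prod.smul_mk, Prod.neg_mk]

/-- The grading of `𝔤' × 𝔤''` by `ad (h', h'')` is componentwise ("the decomposition [is] a graded one").
[cite: LooijengaLunts1997, §1 (1.2) proof p0004 L102–L105] -/
theorem mem_adDegree_prod_iff {h₁ : L₁} {h₂ : L₂} {c : K} {x : L₁ × L₂} :
    x ∈ adDegree K ((h₁, h₂) : L₁ × L₂) c ↔ x.1 ∈ adDegree K h₁ c ∧ x.2 ∈ adDegree K h₂ c := by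
  simp only [mem_adDegree_iff, LieAlgebra.Prod.bracket_apply, Prod.ext_iff, Prod.smul_fst, Prod.smul_snd]

end Prod

section Subdirect

variable {K : Type*} [Field K] {L₁ L₂ : Type*} [LieRing L₁] [LieAlgebra K L₁] [LieRing L₂] [LieAlgebra K L₂]
  [Module.Finite K L₁] [Module.Finite K L₂]

/-- **A subdirect product of Lie algebras with trivial radical has trivial radical**: if `D ≤ 𝔤' × 𝔤''` projects onto
both factors, the radical of `D` maps into `rad 𝔤' = 0` and `rad 𝔤'' = 0` (images of solvable ideals under surjections,
the tree's `map_radical_le_of_surjective`), so it is `0`.  (The source's "equal to `𝔤(𝔞', M') × 𝔤(𝔞'', M'')`" is the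
case `D = 𝔤' × 𝔤''`.) [cite: LooijengaLunts1997, §1 p0004 L62–L63, L86–L88]
[cite: Bourbaki1989LieGroups13, Ch. I §5 no. 2 Prop. 4 (p0099), §6 no. 1 Remark 3 (p0105)] -/
theorem hasTrivialRadical_of_map_fst_map_snd_eq_top [LieAlgebra.HasTrivialRadical K L₁]
    [LieAlgebra.HasTrivialRadical K L₂] (D : LieSubalgebra K (L₁ × L₂))
    (h1 : D.map (LieHom.fst K L₁ L₂) = ⊤) (h2 : D.map (LieHom.snd K L₁ L₂) = ⊤) :
    LieAlgebra.HasTrivialRadical K D := by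
  haveI : Module.Finite K D := inferInstanceAs (Module.Finite K D.toSubmodule)
  have hs1 : Function.Surjective ((LieHom.fst K L₁ L₂).comp D.incl) := fun y ↦ by
    have hy : y ∈ D.map (LieHom.fst K L₁ L₂) := by rw [h1]; exact LieSubalgebra.mem_top y
    obtain ⟨x, hx, rfl⟩ := (LieSubalgebra.mem_map _ _ _).1 hy
    exact ⟨⟨x, hx⟩, rfl⟩
  have hs2 : Function.Surjective ((LieHom.snd K L₁ L₂).comp D.incl) := fun y ↦ by
    have hy : y ∈ D.map (LieHom.snd K L₁ L₂) := by rw [h2]; exact LieSubalgebra.mem_top y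
    obtain ⟨x, hx, rfl⟩ := (LieSubalgebra.mem_map _ _ _).1 hy
    exact ⟨⟨x, hx⟩, rfl⟩
  rw [LieAlgebra.hasTrivialRadical_iff, LieSubmodule.eq_bot_iff]
  intro x hx
  have k1 := map_radical_le_of_surjective hs1 (LieIdeal.mem_map hx)
  have k2 := map_radical_le_of_surjective hs2 (LieIdeal.mem_map hx)
  rw [LieAlgebra.HasTrivialRadical.radical_eq_bot, LieSubmodule.mem_bot] at k1 k2
  exact Subtype.ext (Prod.ext k1 k2)

/-- … hence (characteristic `0`) **a subdirect product of semisimple Lie algebras is semisimple** (Cartan's criterion,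
Mathlib `HasTrivialRadical.instIsKilling`, `IsKilling.instSemisimple`). [cite: LooijengaLunts1997, §1 p0004 L62–L63, L86–L88]
[cite: Bourbaki1989LieGroups13, Ch. I §6 no. 1 Remark 3 (p0105)] -/
theorem isSemisimple_of_map_fst_map_snd_eq_top [CharZero K] [LieAlgebra.IsSemisimple K L₁]
    [LieAlgebra.IsSemisimple K L₂] (D : LieSubalgebra K (L₁ × L₂))
    (h1 : D.map (LieHom.fst K L₁ L₂) = ⊤) (h2 : D.map (LieHom.snd K L₁ L₂) = ⊤) :
    LieAlgebra.IsSemisimple K D := by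
  haveI : Module.Finite K D := inferInstanceAs (Module.Finite K D.toSubmodule)
  haveI := hasTrivialRadical_of_map_fst_map_snd_eq_top D h1 h2
  haveI := LieAlgebra.HasTrivialRadical.instIsKilling K D
  exact LieAlgebra.IsKilling.instSemisimple K D

end Subdirect

/-! ### §2 One `𝔞` in two Lefschetz triples: `𝔤(𝔠, ·) ≤ 𝔤' × 𝔤''` is a subdirect product and a Lefschetz triple -/

section Common

variable {K : Type*} [Field K] [CharZero K] {L₁ L₂ : Type*} [LieRing L₁] [LieAlgebra K L₁] [LieRing L₂]
  [LieAlgebra K L₂] [FiniteDimensional K L₁] [FiniteDimensional K L₂]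
  {h₁ : L₁} {𝔞₁ : Submodule K L₁} {h₂ : L₂} {𝔞₂ : Submodule K L₂} {𝔠 : Submodule K (L₁ × L₂)}

omit [CharZero K] [FiniteDimensional K L₁] [FiniteDimensional K L₂] in
/-- **`dom f` on the common `𝔠`: an element of `𝔠` is Lefschetz for `h = (h', h'')` iff both components are**
(partners are taken componentwise). [cite: LooijengaLunts1997, §1 (1.2) proof p0004 L109–L111 ("f … written (f', f'')")] -/
theorem mem_lefschetzDomain_common_iff (T₁ : IsLefschetzTriple K h₁ 𝔞₁) (T₂ : IsLefschetzTriple K h₂ 𝔞₂)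
    (h𝔠₁ : 𝔠.map (LinearMap.fst K L₁ L₂) = 𝔞₁) (h𝔠₂ : 𝔠.map (LinearMap.snd K L₁ L₂) = 𝔞₂) {x : L₁ × L₂} :
    x ∈ lefschetzDomain K ((h₁, h₂) : L₁ × L₂) 𝔠 ↔
      x ∈ 𝔠 ∧ x.1 ∈ lefschetzDomain K h₁ 𝔞₁ ∧ x.2 ∈ lefschetzDomain K h₂ 𝔞₂ := by
  constructor
  · rintro ⟨hx, f, t⟩
    obtain ⟨t₁, t₂⟩ := (isSl2Triple_prod_iff T₁.h_ne_zero T₂.h_ne_zero (e₁ := x.1) (e₂ := x.2) (f₁ := f.1)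
      (f₂ := f.2)).1 t
    refine ⟨hx, ⟨?_, f.1, t₁⟩, ⟨?_, f.2, t₂⟩⟩
    · rw [← h𝔠₁]; exact Submodule.mem_map_of_mem hx
    · rw [← h𝔠₂]; exact Submodule.mem_map_of_mem hx
  · rintro ⟨hx, ⟨-, f₁, t₁⟩, ⟨-, f₂, t₂⟩⟩
    exact ⟨hx, (f₁, f₂), (isSl2Triple_prod_iff T₁.h_ne_zero T₂.h_ne_zero).2 ⟨t₁, t₂⟩⟩

/-- **`dom f` on `𝔠` is line-open**: two Zariski-open conditions along the line (A1-113
`IsLefschetzTriple.finite_setOf_add_smul_not_mem_lefschetzDomain` for each factor).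
[cite: LooijengaLunts1997, §1 (1.1) p0004 L31–L32] -/
theorem finite_setOf_add_smul_notMem_lefschetzDomain_common (T₁ : IsLefschetzTriple K h₁ 𝔞₁)
    (T₂ : IsLefschetzTriple K h₂ 𝔞₂) (h𝔠₁ : 𝔠.map (LinearMap.fst K L₁ L₂) = 𝔞₁)
    (h𝔠₂ : 𝔠.map (LinearMap.snd K L₁ L₂) = 𝔞₂) {x d : L₁ × L₂}
    (hx : x ∈ lefschetzDomain K ((h₁, h₂) : L₁ × L₂) 𝔠) (hd : d ∈ 𝔠) :
    {t : K | x + t • d ∉ lefschetzDomain K ((h₁, h₂) : L₁ × L₂) 𝔠}.Finite := by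
  obtain ⟨hx𝔠, hx₁, hx₂⟩ := (mem_lefschetzDomain_common_iff T₁ T₂ h𝔠₁ h𝔠₂).1 hx
  have hd₁ : d.1 ∈ 𝔞₁ := by rw [← h𝔠₁]; exact Submodule.mem_map_of_mem hd
  have hd₂ : d.2 ∈ 𝔞₂ := by rw [← h𝔠₂]; exact Submodule.mem_map_of_mem hd
  refine ((T₁.finite_setOf_add_smul_not_mem_lefschetzDomain hx₁ hd₁).union
    (T₂.finite_setOf_add_smul_not_mem_lefschetzDomain hx₂ hd₂)).subset fun t ht ↦ ?_
  rw [Set.mem_setOf_eq, mem_lefschetzDomain_common_iff T₁ T₂ h𝔠₁ h𝔠₂, not_and_or, not_and_or] at ht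
  rcases ht with ht | ht | ht
  · exact absurd (𝔠.add_mem hx𝔠 (𝔠.smul_mem t hd)) ht
  · exact Or.inl ht
  · exact Or.inr ht

/-- **A common Lefschetz element exists**: some `c ∈ 𝔠` has BOTH components Lefschetz (on the line from a `c'` with
Lefschetz first component to a `c''` with Lefschetz second component all but finitely many points have both; `K` is
infinite). [cite: LooijengaLunts1997, §1 (1.1) p0004 L30–L32 ("for some a ∈ 𝔞, e_a has that property … Zariski open")] -/
theorem nonempty_lefschetzDomain_common (T₁ : IsLefschetzTriple K h₁ 𝔞₁) (T₂ : IsLefschetzTriple K h₂ 𝔞₂)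
    (h𝔠₁ : 𝔠.map (LinearMap.fst K L₁ L₂) = 𝔞₁) (h𝔠₂ : 𝔠.map (LinearMap.snd K L₁ L₂) = 𝔞₂) :
    (lefschetzDomain K ((h₁, h₂) : L₁ × L₂) 𝔠).Nonempty := by
  haveI : Infinite K := Infinite.of_injective _ Nat.cast_injective
  obtain ⟨a₁, ha₁⟩ := T₁.nonempty_lefschetzDomain
  obtain ⟨a₂, ha₂⟩ := T₂.nonempty_lefschetzDomain
  have ha₁' : a₁ ∈ 𝔠.map (LinearMap.fst K L₁ L₂) := by rw [h𝔠₁]; exact ha₁.1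
  have ha₂' : a₂ ∈ 𝔠.map (LinearMap.snd K L₁ L₂) := by rw [h𝔠₂]; exact ha₂.1
  obtain ⟨x, hx, hxa⟩ := Submodule.mem_map.1 ha₁'
  obtain ⟨y, hy, hya⟩ := Submodule.mem_map.1 ha₂'
  simp only [LinearMap.fst_apply] at hxa
  simp only [LinearMap.snd_apply] at hya
  -- the line `x + t (y - x)`: first components through `x.1 = a₁`, second components through `y.2 = a₂` at `t = 1`
  have hy₁ : (y - x).1 ∈ 𝔞₁ := by rw [← h𝔠₁]; exact Submodule.mem_map_of_mem (𝔠.sub_mem hy hx)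
  have hx₂ : (x - y).2 ∈ 𝔞₂ := by rw [← h𝔠₂]; exact Submodule.mem_map_of_mem (𝔠.sub_mem hx hy)
  have hF₁ := T₁.finite_setOf_add_smul_not_mem_lefschetzDomain (hxa.symm ▸ ha₁) hy₁
  have hF₂ := T₂.finite_setOf_add_smul_not_mem_lefschetzDomain (hya.symm ▸ ha₂) hx₂
  have hF₂' : {t : K | (x + t • (y - x)).2 ∉ lefschetzDomain K h₂ 𝔞₂}.Finite := by
    refine (hF₂.image fun s : K ↦ 1 - s).subset fun t ht ↦ ⟨1 - t, ?_, by ring⟩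
    rw [Set.mem_setOf_eq] at ht ⊢
    have h1 : y.2 + (1 - t) • (x - y).2 = (x + t • (y - x)).2 := by
      simp only [Prod.snd_add, Prod.smul_snd, Prod.snd_sub, smul_sub, sub_smul, one_smul]
      abel
    rwa [h1]
  have hF₁' : {t : K | (x + t • (y - x)).1 ∉ lefschetzDomain K h₁ 𝔞₁}.Finite := by
    refine hF₁.subset fun t ht ↦ ?_
    rw [Set.mem_setOf_eq] at ht ⊢
    simpa only [Prod.fst_add, Prod.smul_fst] using ht
  obtain ⟨t, ht⟩ := ((hF₁'.union hF₂').infinite_compl).nonempty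
  rw [Set.mem_compl_iff, Set.mem_union, not_or, Set.mem_setOf_eq, Set.mem_setOf_eq, not_not, not_not] at ht
  exact ⟨x + t • (y - x), (mem_lefschetzDomain_common_iff T₁ T₂ h𝔠₁ h𝔠₂).2
    ⟨𝔠.add_mem hx (𝔠.smul_mem t (𝔠.sub_mem hy hx)), ht.1, ht.2⟩⟩

omit [CharZero K] [FiniteDimensional K L₁] [FiniteDimensional K L₂] in
/-- The first components of the partners of `𝔠` are the partners of the first components ("`f = (f', f'')`").
[cite: LooijengaLunts1997, §1 (1.2) proof p0004 L109–L111] -/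
theorem image_fst_lefschetzDuals_common (T₁ : IsLefschetzTriple K h₁ 𝔞₁) (T₂ : IsLefschetzTriple K h₂ 𝔞₂) :
    Prod.fst '' lefschetzDuals K ((h₁, h₂) : L₁ × L₂) 𝔠 =
      {f | ∃ e ∈ Prod.fst '' lefschetzDomain K ((h₁, h₂) : L₁ × L₂) 𝔠, IsSl2Triple h₁ e f} := by
  ext f
  constructor
  · rintro ⟨y, ⟨x, hx, t⟩, rfl⟩
    have t' := (isSl2Triple_prod_iff T₁.h_ne_zero T₂.h_ne_zero (e₁ := x.1) (e₂ := x.2) (f₁ := y.1) (f₂ := y.2)).1 t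
    exact ⟨x.1, ⟨x, ⟨hx, y, t⟩, rfl⟩, t'.1⟩
  · rintro ⟨_, ⟨x, ⟨hx, y, t⟩, rfl⟩, tf⟩
    have t' := (isSl2Triple_prod_iff T₁.h_ne_zero T₂.h_ne_zero (e₁ := x.1) (e₂ := x.2) (f₁ := y.1) (f₂ := y.2)).1 t
    refine ⟨(f, y.2), ⟨x, hx, ?_⟩, rfl⟩
    exact (isSl2Triple_prod_iff T₁.h_ne_zero T₂.h_ne_zero (e₁ := x.1) (e₂ := x.2)).2 ⟨tf, t'.2⟩

omit [CharZero K] [FiniteDimensional K L₁] [FiniteDimensional K L₂] in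
/-- Symmetrically for the second components. [cite: LooijengaLunts1997, §1 (1.2) proof p0004 L109–L111] -/
theorem image_snd_lefschetzDuals_common (T₁ : IsLefschetzTriple K h₁ 𝔞₁) (T₂ : IsLefschetzTriple K h₂ 𝔞₂) :
    Prod.snd '' lefschetzDuals K ((h₁, h₂) : L₁ × L₂) 𝔠 =
      {f | ∃ e ∈ Prod.snd '' lefschetzDomain K ((h₁, h₂) : L₁ × L₂) 𝔠, IsSl2Triple h₂ e f} := by
  ext f
  constructor
  · rintro ⟨y, ⟨x, hx, t⟩, rfl⟩
    have t' := (isSl2Triple_prod_iff T₁.h_ne_zero T₂.h_ne_zero (e₁ := x.1) (e₂ := x.2) (f₁ := y.1) (f₂ := y.2)).1 t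
    exact ⟨x.2, ⟨x, ⟨hx, y, t⟩, rfl⟩, t'.2⟩
  · rintro ⟨_, ⟨x, ⟨hx, y, t⟩, rfl⟩, tf⟩
    have t' := (isSl2Triple_prod_iff T₁.h_ne_zero T₂.h_ne_zero (e₁ := x.1) (e₂ := x.2) (f₁ := y.1) (f₂ := y.2)).1 t
    refine ⟨(y.1, f), ⟨x, hx, ?_⟩, rfl⟩
    exact (isSl2Triple_prod_iff T₁.h_ne_zero T₂.h_ne_zero (e₁ := x.1) (e₂ := x.2)).2 ⟨t'.1, tf⟩

/-- **`𝔤(𝔠, ·)` projects ONTO `𝔤'`**: its image under the first projection is generated by `𝔞'` and the partners of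
the first components of `dom f(𝔠)` — a non-empty line-open subset of `dom f(𝔞')` — hence is everything, by generic
generation (A1-139). [cite: LooijengaLunts1997, §1 p0004 L62–L63 ("closed under direct sums, tensor products"), L86–L88, p0007 L66] -/
theorem map_fst_lefschetzLieAlgebra_common_eq_top (T₁ : IsLefschetzTriple K h₁ 𝔞₁) (T₂ : IsLefschetzTriple K h₂ 𝔞₂)
    (h𝔠₁ : 𝔠.map (LinearMap.fst K L₁ L₂) = 𝔞₁) (h𝔠₂ : 𝔠.map (LinearMap.snd K L₁ L₂) = 𝔞₂) :
    (lefschetzLieAlgebra K ((h₁, h₂) : L₁ × L₂) 𝔠).map (LieHom.fst K L₁ L₂) = ⊤ := by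
  set U : Set L₁ := Prod.fst '' lefschetzDomain K ((h₁, h₂) : L₁ × L₂) 𝔠 with hU
  have hUsub : U ⊆ lefschetzDomain K h₁ 𝔞₁ := by
    rintro _ ⟨x, hx, rfl⟩
    exact ((mem_lefschetzDomain_common_iff T₁ T₂ h𝔠₁ h𝔠₂).1 hx).2.1
  have hUne : U.Nonempty := (nonempty_lefschetzDomain_common T₁ T₂ h𝔠₁ h𝔠₂).image _
  have hUline : ∀ a ∈ U, ∀ b ∈ 𝔞₁, {t : K | a + t • b ∉ U}.Finite := by
    rintro _ ⟨x, hx, rfl⟩ b hb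
    have hb' : b ∈ 𝔠.map (LinearMap.fst K L₁ L₂) := by rw [h𝔠₁]; exact hb
    obtain ⟨d, hd, rfl⟩ := Submodule.mem_map.1 hb'
    refine (finite_setOf_add_smul_notMem_lefschetzDomain_common T₁ T₂ h𝔠₁ h𝔠₂ hx hd).subset fun t ht ↦ ?_
    rw [Set.mem_setOf_eq] at ht ⊢
    intro hmem
    exact ht ⟨x + t • d, hmem, by simp⟩
  have hgen : 𝔞₁ = 𝔠.map (LieHom.fst K L₁ L₂ : L₁ × L₂ →ₗ[K] L₁) := h𝔠₁.symm
  rw [lefschetzLieAlgebra, map_lieSpan, Set.image_union, ← T₁.lieSpan_union_duals_eq_top_of_lineOpen hUsub hUne hUline,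
    hgen, Submodule.map_coe]
  congr 2
  exact image_fst_lefschetzDuals_common T₁ T₂

/-- **`𝔤(𝔠, ·)` projects ONTO `𝔤''`** (symmetrically). [cite: LooijengaLunts1997, §1 p0004 L62–L63, L86–L88, p0007 L66] -/
theorem map_snd_lefschetzLieAlgebra_common_eq_top (T₁ : IsLefschetzTriple K h₁ 𝔞₁) (T₂ : IsLefschetzTriple K h₂ 𝔞₂)
    (h𝔠₁ : 𝔠.map (LinearMap.fst K L₁ L₂) = 𝔞₁) (h𝔠₂ : 𝔠.map (LinearMap.snd K L₁ L₂) = 𝔞₂) :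
    (lefschetzLieAlgebra K ((h₁, h₂) : L₁ × L₂) 𝔠).map (LieHom.snd K L₁ L₂) = ⊤ := by
  set U : Set L₂ := Prod.snd '' lefschetzDomain K ((h₁, h₂) : L₁ × L₂) 𝔠 with hU
  have hUsub : U ⊆ lefschetzDomain K h₂ 𝔞₂ := by
    rintro _ ⟨x, hx, rfl⟩
    exact ((mem_lefschetzDomain_common_iff T₁ T₂ h𝔠₁ h𝔠₂).1 hx).2.2
  have hUne : U.Nonempty := (nonempty_lefschetzDomain_common T₁ T₂ h𝔠₁ h𝔠₂).image _
  have hUline : ∀ a ∈ U, ∀ b ∈ 𝔞₂, {t : K | a + t • b ∉ U}.Finite := by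
    rintro _ ⟨x, hx, rfl⟩ b hb
    have hb' : b ∈ 𝔠.map (LinearMap.snd K L₁ L₂) := by rw [h𝔠₂]; exact hb
    obtain ⟨d, hd, rfl⟩ := Submodule.mem_map.1 hb'
    refine (finite_setOf_add_smul_notMem_lefschetzDomain_common T₁ T₂ h𝔠₁ h𝔠₂ hx hd).subset fun t ht ↦ ?_
    rw [Set.mem_setOf_eq] at ht ⊢
    intro hmem
    exact ht ⟨x + t • d, hmem, by simp⟩
  have hgen : 𝔞₂ = 𝔠.map (LieHom.snd K L₁ L₂ : L₁ × L₂ →ₗ[K] L₂) := h𝔠₂.symm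
  rw [lefschetzLieAlgebra, map_lieSpan, Set.image_union, ← T₂.lieSpan_union_duals_eq_top_of_lineOpen hUsub hUne hUline,
    hgen, Submodule.map_coe]
  congr 2
  exact image_snd_lefschetzDuals_common T₁ T₂

/-- **`𝔤(𝔠, ·)` is semisimple**: a subdirect product of the semisimple `𝔤'`, `𝔤''` — the clause "`𝔤(𝔞, M)` is
semisimple" of "`(𝔞, M' ⊕ M'')`, `(𝔞, M' ⊗ M'')` are Lefschetz modules". [cite: LooijengaLunts1997, §1 p0004 L56–L58 ("(𝔞,M) is a Lefschetz module if 𝔤(𝔞,M) is semisimple"), L62–L63] -/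
theorem isSemisimple_lefschetzLieAlgebra_common (T₁ : IsLefschetzTriple K h₁ 𝔞₁) (T₂ : IsLefschetzTriple K h₂ 𝔞₂)
    (h𝔠₁ : 𝔠.map (LinearMap.fst K L₁ L₂) = 𝔞₁) (h𝔠₂ : 𝔠.map (LinearMap.snd K L₁ L₂) = 𝔞₂) :
    LieAlgebra.IsSemisimple K (lefschetzLieAlgebra K ((h₁, h₂) : L₁ × L₂) 𝔠) := by
  haveI := T₁.isSemisimple
  haveI := T₂.isSemisimple
  exact isSemisimple_of_map_fst_map_snd_eq_top _ (map_fst_lefschetzLieAlgebra_common_eq_top T₁ T₂ h𝔠₁ h𝔠₂)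
    (map_snd_lefschetzLieAlgebra_common_eq_top T₁ T₂ h𝔠₁ h𝔠₂)

/-- `h = (h', h'')` lies in `𝔤(𝔠, ·)` (it is `[c, f_c]` for a common Lefschetz `c`). [cite: LooijengaLunts1997, §1 (1.1) p0004 L56–L57] -/
theorem h_mem_lefschetzLieAlgebra_common (T₁ : IsLefschetzTriple K h₁ 𝔞₁) (T₂ : IsLefschetzTriple K h₂ 𝔞₂)
    (h𝔠₁ : 𝔠.map (LinearMap.fst K L₁ L₂) = 𝔞₁) (h𝔠₂ : 𝔠.map (LinearMap.snd K L₁ L₂) = 𝔞₂) :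
    ((h₁, h₂) : L₁ × L₂) ∈ lefschetzLieAlgebra K ((h₁, h₂) : L₁ × L₂) 𝔠 := by
  obtain ⟨e, he, f, t⟩ := nonempty_lefschetzDomain_common T₁ T₂ h𝔠₁ h𝔠₂
  exact h_mem_lefschetzLieAlgebra_of_isSl2Triple he t

/-- **MAIN THEOREM.  One `𝔞` in two Lefschetz triples gives a Lefschetz triple `(𝔤(𝔠, ·), (h', h''), 𝔠)`** inside
`𝔤' × 𝔤''`: semisimple (subdirect product), `𝔠 ⊆ 𝔤₂` abelian, `dom f ≠ ∅` (a common Lefschetz element), generated by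
`𝔠` and the image of `f`.  With A1-106/A1-137 every representation `V` of it with `h V ≠ 0` (`M' ⊕ M''`, `M' ⊗ M''`) is
a Lefschetz `𝔠`-module with `𝔤(𝔠, V)` its image — "the collection of Lefschetz modules is closed under direct sums,
tensor products". [cite: LooijengaLunts1997, §1 p0004 L62–L63, L72–L88; §1 p0007 L54–L78 (Lefschetz triples)] -/
theorem isLefschetzTriple_lefschetzLieAlgebra_common (T₁ : IsLefschetzTriple K h₁ 𝔞₁) (T₂ : IsLefschetzTriple K h₂ 𝔞₂)
    (h𝔠₁ : 𝔠.map (LinearMap.fst K L₁ L₂) = 𝔞₁) (h𝔠₂ : 𝔠.map (LinearMap.snd K L₁ L₂) = 𝔞₂) :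
    IsLefschetzTriple K
      (⟨(h₁, h₂), h_mem_lefschetzLieAlgebra_common T₁ T₂ h𝔠₁ h𝔠₂⟩ : lefschetzLieAlgebra K ((h₁, h₂) : L₁ × L₂) 𝔠)
      (inSubalgebra (lefschetzLieAlgebra K ((h₁, h₂) : L₁ × L₂) 𝔠) 𝔠) where
  isSemisimple := isSemisimple_lefschetzLieAlgebra_common T₁ T₂ h𝔠₁ h𝔠₂
  le_adDegree_two x hx := by
    rw [mem_adDegree_iff]
    apply Subtype.ext
    have hx₁ : (x : L₁ × L₂).1 ∈ 𝔞₁ := by rw [← h𝔠₁]; exact Submodule.mem_map_of_mem hx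
    have hx₂ : (x : L₁ × L₂).2 ∈ 𝔞₂ := by rw [← h𝔠₂]; exact Submodule.mem_map_of_mem hx
    have h1 := mem_adDegree_prod_iff.2 ⟨T₁.le_adDegree_two hx₁, T₂.le_adDegree_two hx₂⟩
    exact mem_adDegree_iff.1 h1
  lie_eq_zero x hx y hy := by
    apply Subtype.ext
    have hx₁ : (x : L₁ × L₂).1 ∈ 𝔞₁ := by rw [← h𝔠₁]; exact Submodule.mem_map_of_mem hx
    have hx₂ : (x : L₁ × L₂).2 ∈ 𝔞₂ := by rw [← h𝔠₂]; exact Submodule.mem_map_of_mem hx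
    have hy₁ : (y : L₁ × L₂).1 ∈ 𝔞₁ := by rw [← h𝔠₁]; exact Submodule.mem_map_of_mem hy
    have hy₂ : (y : L₁ × L₂).2 ∈ 𝔞₂ := by rw [← h𝔠₂]; exact Submodule.mem_map_of_mem hy
    show ⁅(x : L₁ × L₂), (y : L₁ × L₂)⁆ = 0
    rw [LieAlgebra.Prod.bracket_apply, T₁.lie_eq_zero _ hx₁ _ hy₁, T₂.lie_eq_zero _ hx₂ _ hy₂]
    rfl
  nonempty_lefschetzDomain := by
    obtain ⟨e, he⟩ := nonempty_lefschetzDomain_common T₁ T₂ h𝔠₁ h𝔠₂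
    refine ⟨⟨e, le_lefschetzLieAlgebra he.1⟩, ?_⟩
    rw [← preimage_coe_lefschetzDomain lefschetzDuals_subset_lefschetzLieAlgebra
      (h_mem_lefschetzLieAlgebra_common T₁ T₂ h𝔠₁ h𝔠₂)]
    exact he
  lieSpan_eq_top := lefschetzLieAlgebra_inSubalgebra_eq_top (h_mem_lefschetzLieAlgebra_common T₁ T₂ h𝔠₁ h𝔠₂)

omit [CharZero K] [FiniteDimensional K L₁] [FiniteDimensional K L₂] in
/-- The exterior case `𝔠 = 𝔞' × 𝔞''` satisfies the hypotheses (so `(𝔤(𝔞' × 𝔞'', ·), h, 𝔞' × 𝔞'')` is a Lefschetz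
triple inside `𝔤' × 𝔤''`; that it is ALL of `𝔤' × 𝔤''` is A1-99 at the module level). [cite: LooijengaLunts1997, §1 p0004 L72–L88] -/
theorem map_fst_prod_submodule_eq (h𝔞₂ : (0 : L₂) ∈ 𝔞₂) : (𝔞₁.prod 𝔞₂).map (LinearMap.fst K L₁ L₂) = 𝔞₁ := by
  ext a
  simp only [Submodule.mem_map, Submodule.mem_prod, LinearMap.fst_apply]
  exact ⟨by rintro ⟨x, ⟨hx, -⟩, rfl⟩; exact hx, fun ha ↦ ⟨(a, 0), ⟨ha, h𝔞₂⟩, rfl⟩⟩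

omit [CharZero K] [FiniteDimensional K L₁] [FiniteDimensional K L₂] in
/-- … and symmetrically. [cite: LooijengaLunts1997, §1 p0004 L72–L88] -/
theorem map_snd_prod_submodule_eq (h𝔞₁ : (0 : L₁) ∈ 𝔞₁) : (𝔞₁.prod 𝔞₂).map (LinearMap.snd K L₁ L₂) = 𝔞₂ := by
  ext a
  simp only [Submodule.mem_map, Submodule.mem_prod, LinearMap.snd_apply]
  exact ⟨by rintro ⟨x, ⟨-, hx⟩, rfl⟩; exact hx, fun ha ↦ ⟨(0, a), ⟨h𝔞₁, ha⟩, rfl⟩⟩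

end Common

/-! ### §3 The exterior case `𝔠 = 𝔞' × 𝔞''`: `𝔤(𝔞' × 𝔞'', ·)` is ALL of `𝔤' × 𝔤''`, and `(𝔤' × 𝔤'', (h', h''), 𝔞' × 𝔞'')` is a Lefschetz triple -/

section Exterior

variable {K : Type*} [Field K] [CharZero K] {L₁ L₂ : Type*} [LieRing L₁] [LieAlgebra K L₁] [LieRing L₂]
  [LieAlgebra K L₂] {h₁ : L₁} {𝔞₁ : Submodule K L₁} {h₂ : L₂} {𝔞₂ : Submodule K L₂}

omit [CharZero K] in
/-- Rescaling an `𝔰𝔩₂`-triple of any Lie algebra by a unit: `(c e, h, c⁻¹ f)` is an `𝔰𝔩₂`-triple (so `dom f` is a cone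
and `f_{c a} = c⁻¹ f_a`: "a rational map `f : 𝔞 → 𝔤₋₂`"). [cite: LooijengaLunts1997, §1 (1.1) p0004 L31–L35, §1 p0007 L61–L64] -/
theorem isSl2Triple_smul_of_ne_zero {L : Type*} [LieRing L] [LieAlgebra K L] {h e f : L} (t : IsSl2Triple h e f)
    {c : K} (hc : c ≠ 0) : IsSl2Triple h (c • e) (c⁻¹ • f) where
  h_ne_zero := t.h_ne_zero
  lie_e_f := by rw [smul_lie, lie_smul, smul_smul, mul_inv_cancel₀ hc, one_smul, t.lie_e_f]
  lie_h_e_nsmul := by rw [lie_smul, t.lie_h_e_nsmul, smul_comm]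
  lie_h_f_nsmul := by rw [lie_smul, t.lie_h_f_nsmul, smul_neg, smul_comm]

/-- In the exterior case the partners `(f_a, 0)` and `(0, f_b)` lie in `𝔤(𝔞' × 𝔞'', ·)` separately: with `b ∈ dom f(𝔞'')`,
both `(f_a, f_b)` and `(f_a, ½ f_b)` (the partners of `(a, b)`, `(a, 2b) ∈ 𝔞' × 𝔞''`) do.
[cite: LooijengaLunts1997, §1 p0004 L86–L87 ("The associated Lie algebra is in the first case equal to 𝔤(𝔞', M') × 𝔤(𝔞'', M'')")] -/
theorem inl_mem_lefschetzLieAlgebra_prod_of_isSl2Triple (T₂ : IsLefschetzTriple K h₂ 𝔞₂) {a fa : L₁} (ha : a ∈ 𝔞₁)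
    (ta : IsSl2Triple h₁ a fa) :
    ((fa, 0) : L₁ × L₂) ∈ lefschetzLieAlgebra K ((h₁, h₂) : L₁ × L₂) (𝔞₁.prod 𝔞₂) := by
  obtain ⟨b, hb, fb, tb⟩ := T₂.nonempty_lefschetzDomain
  set D := lefschetzLieAlgebra K ((h₁, h₂) : L₁ × L₂) (𝔞₁.prod 𝔞₂) with hD
  have two0 : (2 : K) ≠ 0 := two_ne_zero
  have h1 : ((fa, fb) : L₁ × L₂) ∈ D :=
    mem_lefschetzLieAlgebra_of_isSl2Triple (Submodule.mem_prod.2 ⟨ha, hb⟩)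
      ((isSl2Triple_prod_iff ta.h_ne_zero tb.h_ne_zero).2 ⟨ta, tb⟩)
  have h2 : ((fa, (2 : K)⁻¹ • fb) : L₁ × L₂) ∈ D :=
    mem_lefschetzLieAlgebra_of_isSl2Triple (Submodule.mem_prod.2 ⟨ha, 𝔞₂.smul_mem (2 : K) hb⟩)
      ((isSl2Triple_prod_iff ta.h_ne_zero tb.h_ne_zero (e₂ := (2 : K) • b)).2
        ⟨ta, isSl2Triple_smul_of_ne_zero tb two0⟩)
  have h3 : ((fa, 0) : L₁ × L₂) = (2 : K) • ((fa, (2 : K)⁻¹ • fb) : L₁ × L₂) - ((fa, fb) : L₁ × L₂) := by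
    rw [Prod.smul_mk, Prod.mk_sub_mk, smul_smul, mul_inv_cancel₀ two0, one_smul, sub_self, two_smul,
      add_sub_cancel_right]
  rw [h3]
  exact D.sub_mem (D.smul_mem (2 : K) h2) h1

/-- Symmetrically, `(0, f_b) ∈ 𝔤(𝔞' × 𝔞'', ·)`. [cite: LooijengaLunts1997, §1 p0004 L86–L87] -/
theorem inr_mem_lefschetzLieAlgebra_prod_of_isSl2Triple (T₁ : IsLefschetzTriple K h₁ 𝔞₁) {b fb : L₂} (hb : b ∈ 𝔞₂)
    (tb : IsSl2Triple h₂ b fb) :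
    ((0, fb) : L₁ × L₂) ∈ lefschetzLieAlgebra K ((h₁, h₂) : L₁ × L₂) (𝔞₁.prod 𝔞₂) := by
  obtain ⟨a, ha, fa, ta⟩ := T₁.nonempty_lefschetzDomain
  set D := lefschetzLieAlgebra K ((h₁, h₂) : L₁ × L₂) (𝔞₁.prod 𝔞₂) with hD
  have two0 : (2 : K) ≠ 0 := two_ne_zero
  have h1 : ((fa, fb) : L₁ × L₂) ∈ D :=
    mem_lefschetzLieAlgebra_of_isSl2Triple (Submodule.mem_prod.2 ⟨ha, hb⟩)
      ((isSl2Triple_prod_iff ta.h_ne_zero tb.h_ne_zero).2 ⟨ta, tb⟩)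
  have h2 : ((((2 : K)⁻¹ • fa), fb) : L₁ × L₂) ∈ D :=
    mem_lefschetzLieAlgebra_of_isSl2Triple (Submodule.mem_prod.2 ⟨𝔞₁.smul_mem (2 : K) ha, hb⟩)
      ((isSl2Triple_prod_iff ta.h_ne_zero tb.h_ne_zero (e₁ := (2 : K) • a)).2
        ⟨isSl2Triple_smul_of_ne_zero ta two0, tb⟩)
  have h3 : ((0, fb) : L₁ × L₂) = (2 : K) • ((((2 : K)⁻¹ • fa), fb) : L₁ × L₂) - ((fa, fb) : L₁ × L₂) := by
    rw [Prod.smul_mk, Prod.mk_sub_mk, smul_smul, mul_inv_cancel₀ two0, one_smul, sub_self, two_smul,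
      add_sub_cancel_right]
  rw [h3]
  exact D.sub_mem (D.smul_mem (2 : K) h2) h1

/-- **"The associated Lie algebra is in the first case equal to `𝔤(𝔞', M') × 𝔤(𝔞'', M'')`", at the level of triples**: for
Lefschetz triples `(𝔤', h', 𝔞')`, `(𝔤'', h'', 𝔞'')`, the Lie subalgebra of `𝔤' × 𝔤''` generated by `𝔞' × 𝔞''` and the partners
of its Lefschetz elements is EVERYTHING (the module level is A1-99 `lefschetzLieAlgebra_prod_eq`).
[cite: LooijengaLunts1997, §1 p0004 L72–L87] -/
theorem lefschetzLieAlgebra_prod_submodule_eq_top (T₁ : IsLefschetzTriple K h₁ 𝔞₁) (T₂ : IsLefschetzTriple K h₂ 𝔞₂) :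
    lefschetzLieAlgebra K ((h₁, h₂) : L₁ × L₂) (𝔞₁.prod 𝔞₂) = ⊤ := by
  set D := lefschetzLieAlgebra K ((h₁, h₂) : L₁ × L₂) (𝔞₁.prod 𝔞₂) with hD
  -- `𝔤' × 0 ≤ D` and `0 × 𝔤'' ≤ D`, through the generators of `𝔤'`, `𝔤''`
  have hl : (⊤ : LieSubalgebra K L₁).map (LieHom.inl K L₁ L₂) ≤ D := by
    rw [← T₁.lieSpan_eq_top, map_lieSpan, LieSubalgebra.lieSpan_le]
    rintro _ ⟨x, hx | ⟨a, ha, t⟩, rfl⟩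
    · exact mem_lefschetzLieAlgebra_of_mem (Submodule.mem_prod.2 ⟨hx, 𝔞₂.zero_mem⟩)
    · exact inl_mem_lefschetzLieAlgebra_prod_of_isSl2Triple T₂ ha t
  have hr : (⊤ : LieSubalgebra K L₂).map (LieHom.inr K L₁ L₂) ≤ D := by
    rw [← T₂.lieSpan_eq_top, map_lieSpan, LieSubalgebra.lieSpan_le]
    rintro _ ⟨y, hy | ⟨b, hb, t⟩, rfl⟩
    · exact mem_lefschetzLieAlgebra_of_mem (Submodule.mem_prod.2 ⟨𝔞₁.zero_mem, hy⟩)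
    · exact inr_mem_lefschetzLieAlgebra_prod_of_isSl2Triple T₁ hb t
  rw [eq_top_iff]
  rintro ⟨x, y⟩ -
  have hx : ((x, 0) : L₁ × L₂) ∈ D := hl ((LieSubalgebra.mem_map _ _ _).2 ⟨x, LieSubalgebra.mem_top x, rfl⟩)
  have hy : ((0, y) : L₁ × L₂) ∈ D := hr ((LieSubalgebra.mem_map _ _ _).2 ⟨y, LieSubalgebra.mem_top y, rfl⟩)
  have hxy : ((x, y) : L₁ × L₂) = (x, 0) + (0, y) := by simp
  rw [hxy]
  exact D.add_mem hx hy

variable [FiniteDimensional K L₁] [FiniteDimensional K L₂]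

/-- **The exterior direct sum of Lefschetz triples is a Lefschetz triple `(𝔤' × 𝔤'', (h', h''), 𝔞' × 𝔞'')`** (semisimple
product, A1-99 `isSemisimple_prod`; componentwise degree `2` and abelian; `(a, b)` Lefschetz for `a ∈ dom f(𝔞')`,
`b ∈ dom f(𝔞'')`; generation by `lefschetzLieAlgebra_prod_submodule_eq_top`).
[cite: LooijengaLunts1997, §1 p0004 L72–L87, §1 p0007 L54–L78] -/
theorem IsLefschetzTriple.prod (T₁ : IsLefschetzTriple K h₁ 𝔞₁) (T₂ : IsLefschetzTriple K h₂ 𝔞₂) :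
    IsLefschetzTriple K ((h₁, h₂) : L₁ × L₂) (𝔞₁.prod 𝔞₂) where
  isSemisimple := by
    haveI := T₁.isSemisimple
    haveI := T₂.isSemisimple
    exact isSemisimple_prod
  le_adDegree_two x hx :=
    mem_adDegree_prod_iff.2 ⟨T₁.le_adDegree_two (Submodule.mem_prod.1 hx).1, T₂.le_adDegree_two (Submodule.mem_prod.1 hx).2⟩
  lie_eq_zero x hx y hy := by
    rw [LieAlgebra.Prod.bracket_apply, T₁.lie_eq_zero _ (Submodule.mem_prod.1 hx).1 _ (Submodule.mem_prod.1 hy).1,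
      T₂.lie_eq_zero _ (Submodule.mem_prod.1 hx).2 _ (Submodule.mem_prod.1 hy).2]
    rfl
  nonempty_lefschetzDomain :=
    nonempty_lefschetzDomain_common T₁ T₂ (map_fst_prod_submodule_eq 𝔞₂.zero_mem) (map_snd_prod_submodule_eq 𝔞₁.zero_mem)
  lieSpan_eq_top := lefschetzLieAlgebra_prod_submodule_eq_top T₁ T₂

end Exterior

/-! ## §4 (rider) The product of Jordan–Lefschetz pairs -/

section JordanExterior

variable {K : Type*} [Field K] [CharZero K] {L₁ L₂ : Type*} [LieRing L₁] [LieAlgebra K L₁] [LieRing L₂]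
  [LieAlgebra K L₂] [FiniteDimensional K L₁] [FiniteDimensional K L₂]

omit [CharZero K] [FiniteDimensional K L₁] [FiniteDimensional K L₂] in
/-- The degrees of `(𝔤' × 𝔤'', (h', h''))` are the products of the degrees: `𝔤_c = 𝔤'_c × 𝔤''_c`.
[cite: LooijengaLunts1997, §1 (1.2) proof p0004 L102–L105 ("the decomposition [is] a graded one")] -/
theorem adDegree_prod_eq (h₁ : L₁) (h₂ : L₂) (c : K) :
    adDegree K ((h₁, h₂) : L₁ × L₂) c = (adDegree K h₁ c).prod (adDegree K h₂ c) := by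
  ext x
  rw [mem_adDegree_prod_iff, Submodule.mem_prod]

/-- **The product of two Jordan–Lefschetz pairs is a Jordan–Lefschetz pair**: `(𝔤' × 𝔤'', (h', h''))` with
`𝔤_2(h', h'') = 𝔤'_2 × 𝔤''_2` (`IsLefschetzTriple.prod` applied to `𝔞' = 𝔤'_2`, `𝔞'' = 𝔤''_2`).  This is how a
semisimple, non-simple Jordan–Lefschetz pair is assembled from the items of the list (2.6) ("every item of this list
determines an isomorphism class"; "In what follows, `(𝔤, h)` is a Jordan–Lefschetz pair with `𝔤` simple").
[cite: LooijengaLunts1997, §1 p0004 L72–L87 (exterior direct sum), §2 (2.6) p0010 L28–L31, p0009 L131] -/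
theorem IsJordanLefschetzPair.prod {h₁ : L₁} {h₂ : L₂} (J₁ : IsJordanLefschetzPair K h₁)
    (J₂ : IsJordanLefschetzPair K h₂) : IsJordanLefschetzPair K ((h₁, h₂) : L₁ × L₂) := by
  have T := IsLefschetzTriple.prod J₁.isLefschetzTriple J₂.isLefschetzTriple
  rw [← adDegree_prod_eq] at T
  exact T

/-- Hence also a Lefschetz pair. [cite: LooijengaLunts1997, §1 p0004 L72–L87, §2 p0009 L108–L110] -/
theorem IsJordanLefschetzPair.isLefschetzPair_prod {h₁ : L₁} {h₂ : L₂} (J₁ : IsJordanLefschetzPair K h₁)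
    (J₂ : IsJordanLefschetzPair K h₂) : IsLefschetzPair K ((h₁, h₂) : L₁ × L₂) :=
  (J₁.prod J₂).isLefschetzPair

/-- And Lefschetz pairs: `(𝔤', h')`, `(𝔤'', h'')` Lefschetz pairs ⟹ `(𝔤' × 𝔤'', (h', h''))` is a Lefschetz pair.
[cite: LooijengaLunts1997, §1 p0004 L72–L87, p0007 L54–L78] -/
theorem IsLefschetzPair.prod {h₁ : L₁} {h₂ : L₂} (P₁ : IsLefschetzPair K h₁) (P₂ : IsLefschetzPair K h₂) :
    IsLefschetzPair K ((h₁, h₂) : L₁ × L₂) := by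
  obtain ⟨𝔞₁, T₁⟩ := P₁
  obtain ⟨𝔞₂, T₂⟩ := P₂
  exact ⟨_, T₁.prod T₂⟩

end JordanExterior

end Literature.Algebra.Lie
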